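import Mathlib
import Summits.RiemannHypothesis.RiemannHypothesis.Theses.RuelleBand
import Literature.NumberTheory.LFunctions.ZeroCounting

/-!
Sketch for crux-ideate stmt-RiemannHypothesis-2063 (AsymptoticCriticalLine), ideator 1, round 1.
Idea `schatten-defect-weyl-majorant`: first lemmas typed over existing declarations.
Nothing here is proved; the point is that the signatures elaborate.
-/

namespace Summit.RiemannHypothesis.RiemannHypothesis.Cruxes.AsymptoticCriticalLine.SchattenDefectWeylMajorant

open Summit.RiemannHypothesis.RiemannHypothesis.Theses.RuelleBand

/-- The set of non-trivial zeros of `ζ` in the open critical strip, as a subtype. -/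
def NontrivialZero : Type := {s : ℂ // riemannZeta s = 0 ∧ 0 < s.re ∧ s.re < 1}

/-- RUNG `p = 2` (new, RH-implied, strictly above the crux): the squared offsets of the
non-trivial zeros from the critical line are summable. -/
def SquareSummableOffsets : Prop :=
  Summable (fun ρ : NontrivialZero => ((ρ.1).re - 1 / 2) ^ 2)

/-- RUNG `p = 1` (trace-class face; Littlewood–Titchmarsh Thm 9.15: equivalent to
`∫₀ᵀ log|ζ(1/2+it)| dt = O(log T)`): the offsets themselves are summable. -/
def SummableOffsets : Prop :=
  Summable (fun ρ : NontrivialZero => |(ρ.1).re - 1 / 2|)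

/-- THE ENGINE (Weyl's majorant theorem 1949 + compression; Hilbert–Schmidt case), typed in the
style of `BandEngine` but QUANTITATIVE and with NO unitary to choose: a one-parameter GROUP of
bounded operators whose GRAM DEFECT `E := (T t₀)† (T t₀) - 1` at one time `t₀ > 0` is Hilbert–Schmidt has
square-summable real parts of its joint eigenvalues. Proof sketch (finite-dimensional at heart): for a
finite set `F` of joint eigenvalues, `V := span` of the eigenvectors is invariant under every `T t`;
`A := T t₀|_V` is diagonalisable with eigenvalues `e^{t₀ z}` (`z ∈ F`), `log |e^{t₀ z}| = t₀ re z`; Weyl's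
majorant theorem (`log |λ| ≺ log s` on `V`, `x ↦ x²` convex) gives `Σ (t₀ re z)² ≤ Σ (log s_j(A))²`;
`s_j(A)² = 1 +` eigenvalues of the compression `P_V E P_V`, so `Σ (s_j² - 1)² ≤ ‖E‖²_HS`, and
`|log s_j| ≤ ½ |s_j² - 1| · max (1, ‖T (-t₀)‖²)`; the bound is uniform in `F`. Hilbert–Schmidt is spelled
through a Hilbert basis: `Σ_i ‖E (b i)‖² < ∞`. -/
def SchattenTwoEngine : Prop :=
  ∀ (H : Type) [NormedAddCommGroup H] [InnerProductSpace ℂ H] [CompleteSpace H]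
    (T : ℝ → H →L[ℂ] H), T 0 = ContinuousLinearMap.id ℂ H →
    (∀ s t : ℝ, T (s + t) = (T s).comp (T t)) →
    (∃ t₀ : ℝ, 0 < t₀ ∧ ∃ (ι : Type) (b : HilbertBasis ι ℂ H),
      Summable (fun i : ι =>
        ‖((ContinuousLinearMap.adjoint (T t₀)).comp (T t₀) - ContinuousLinearMap.id ℂ H) (b i)‖ ^ 2)) →
    ∀ Z : Set ℂ, (∀ z ∈ Z, ∃ v : H, v ≠ 0 ∧ ∀ t : ℝ, T t v = Complex.exp (↑t * z) • v) →
      Summable (fun z : Z => ((z : ℂ).re) ^ 2)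

/-- THE TYPED SHADOW of the construction (Hilbert–Schmidt strengthening of `BandRealisation`, with the
unitary ELIMINATED): a Hilbert space with a one-parameter group realising every non-trivial zero as a
joint eigenvalue of character `e^{t(ρ - 1/2)}` whose Gram defect `(T t₀)†(T t₀) - 1` is Hilbert–Schmidt
at some time `t₀ > 0`. HONESTY: by the diagonal model (cf. `AsymptoticToRealisation`: there
`(T t₀)†(T t₀) - 1 = diag (e^{2 t₀ (β_n - 1/2)} - 1)`) this is EQUIVALENT to `SquareSummableOffsets`;
the content is a PINNED witness whose Gram defect is an explicit kernel. -/
def SchattenRealisation : Prop :=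
  ∃ (H : Type) (_ : NormedAddCommGroup H) (_ : InnerProductSpace ℂ H) (_ : CompleteSpace H)
    (T : ℝ → H →L[ℂ] H), T 0 = ContinuousLinearMap.id ℂ H ∧
    (∀ s t : ℝ, T (s + t) = (T s).comp (T t)) ∧
    (∃ t₀ : ℝ, 0 < t₀ ∧ ∃ (ι : Type) (b : HilbertBasis ι ℂ H),
      Summable (fun i : ι =>
        ‖((ContinuousLinearMap.adjoint (T t₀)).comp (T t₀) - ContinuousLinearMap.id ℂ H) (b i)‖ ^ 2)) ∧
    (∀ s : ℂ, riemannZeta s = 0 → 0 < s.re → s.re < 1 →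
      ∃ v : H, v ≠ 0 ∧ ∀ t : ℝ, T t v = Complex.exp (↑t * (s - 1 / 2)) • v)

/-- FIRST LEMMA of the line (glue, provable now from the two decls above): engine + realisation give
the `p = 2` rung. -/
def RealisationToSquareSummable : Prop :=
  SchattenTwoEngine → SchattenRealisation → SquareSummableOffsets

/-- The `p = 2` rung implies the crux (summable ⇒ terms → 0 along the cofinite filter ⇒ only
finitely many offsets `≥ ε`). Provable now (S). -/
def SquareSummableToAsymptotic : Prop :=
  SquareSummableOffsets → AsymptoticCriticalLine

/-- CALIBRATION / KNOWN END of the θ-ladder (θ = 1): on every half-plane `re s ≥ 1/2 + ε` the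
reciprocal ordinates of the zeros are summable — a consequence of any zero-density estimate with
exponent `< 1` at `σ = 1/2 + ε` (Ingham: `A(σ) = 3/(2-σ)`, tree named fact `zeroDensity_ingham`;
Selberg 1946 = Titchmarsh Thm 9.19 (C) also suffices), by dyadic summation. Provable now (M). -/
def InverseOrdinateSummable : Prop :=
  Literature.NumberTheory.LFunctions.zeroDensity_ingham →
    ∀ ε : ℝ, 0 < ε →
      Summable (fun ρ : {s : ℂ // riemannZeta s = 0 ∧ 1 / 2 + ε ≤ s.re ∧ s.re < 1 ∧ 0 < s.im} =>
        1 / (ρ.1).im)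

/-- θ-LADDER (interpolating rungs, `0 ≤ θ ≤ 1`): `θ = 1` is `InverseOrdinateSummable` (known),
`θ = 0` is literally the crux (finitely many terms `= 1`); intermediate `θ` are uniform-in-`ε`
power savings for `N(1/2+ε, T)`, beyond mollifier technology (MollifierLimitations). -/
def ThetaRung (θ : ℝ) : Prop :=
  ∀ ε : ℝ, 0 < ε →
    Summable (fun ρ : {s : ℂ // riemannZeta s = 0 ∧ 1 / 2 + ε ≤ s.re ∧ s.re < 1 ∧ 0 < s.im} =>
      (ρ.1).im ^ (-θ))

/-- Sanity glue: the `θ = 0` rung is the (one-sided, upper-half-plane) crux. Provable now (S):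
`x ^ (-0) = 1`, and a family of ones is summable iff its index type is finite; conjugation and
`s ↦ 1 - s` symmetry of the zero set give the two-sided statement. -/
def ThetaZeroIffCrux : Prop :=
  ThetaRung 0 ↔ AsymptoticCriticalLine


/-- Comparison with the route (provable now, S): a Hilbert–Schmidt Gram defect is in particular a compact
perturbation of a unitary (polar decomposition `T t₀ = W |T t₀|`, `W` unitary since `T t₀` is invertible,
`|T t₀| - 1` Hilbert–Schmidt hence compact), so the typed shadow refines `BandRealisation`. -/
def SchattenToBand : Prop :=
  SchattenRealisation → BandRealisation

end Summit.RiemannHypothesis.RiemannHypothesis.Cruxes.AsymptoticCriticalLine.SchattenDefectWeylMajorant
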